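import Summits.AtomisticToContinuum.FouriersLaw.Theses.EmbeddedDrudeMourre
import Literature.MathematicalPhysics.KineticTheory.LangevinChainKernel
import Literature.MathematicalPhysics.KineticTheory.LangevinChainGibbs

/-!
# Sketch — crux ideas for `EmbeddedDrudeMourre.AbelThermodynamicLimit` (stmt-AtomisticToContinuum-12596)

Planner scratch file (crux-ideate, round 1, ideator 3). First lemmas of the idea cards
`Ideas/slow-abel-diagonal.md` and `Ideas/exit-ledger-slip-bound.md`, typed over existing
declarations: `pinnedChain`, `OscillatorChain.bondCurrent`, `.totalCurrent`, `.IsSteadyState`,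
`.transitionKernel` (LangevinChainKernel), `.gibbsMeasure` (LangevinChainGibbs),
`InfiniteChainDynamics`, `.currentCorrelation`, `.IsChainGibbsMeasure` (InfiniteChainDynamics).
Nothing here is a route item; nothing is proved except the two elementary reductions.
-/

noncomputable section

open MeasureTheory Filter Set
open scoped Topology NNReal

namespace Summit.AtomisticToContinuum.FouriersLaw.Cruxes.AbelThermodynamicLimit

open Literature.MathematicalPhysics.KineticTheory.HeatConduction

/-! ### Open-chain equilibrium objects (both baths at `T`) -/

/-- `⟨j_i(0) j_k(t)⟩_{N,T}`: equilibrium pair correlation of bond currents of the open `N`-chain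
(Gibbs measure `gibbsMeasure N T`, constructed kernels `transitionKernel N T T t`). -/
def pairCorr (ω₂ lam β γ T : ℝ) (N : ℕ) (i k : Fin N) (t : ℝ) : ℝ :=
  ∫ z, (pinnedChain ω₂ lam β γ).bondCurrent N i z *
      (∫ y, (pinnedChain ω₂ lam β γ).bondCurrent N k y
          ∂((pinnedChain ω₂ lam β γ).transitionKernel N T T t.toNNReal z))
    ∂((pinnedChain ω₂ lam β γ).gibbsMeasure N T)

/-- The central bond `c_N = ⌊(N-1)/2⌋` (a proper bond `c_N + 1 < N` as soon as `N ≥ 2`). -/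
def centralBond (N : ℕ) (h : 2 ≤ N) : Fin N := ⟨(N - 1) / 2, by omega⟩

/-- ANCHORED ABELIAN SUM `A_N(ν) = Σ_k ∫₀^∞ e^{-νt} ⟨j_{c_N}(0) j_k(t)⟩_{N,T} dt` (junk `0` for `N < 2`).
At `ν = 0` it is `Σ_k ∫₀^∞ ⟨j_c(0) j_k(t)⟩ = T²·D_N` (Kundu–Dhar–Narayan, anchored form). -/
def anchoredAbel (ω₂ lam β γ T : ℝ) (N : ℕ) (ν : ℝ) : ℝ :=
  if h : 2 ≤ N then
    ∑ k : Fin N, ∫ t in Ioi (0:ℝ), Real.exp (-(ν * t)) * pairCorr ω₂ lam β γ T N (centralBond N h) k t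
  else 0

/-- BOUNDARY-IMBALANCE RESPONSE `B_N(t) = ⟨j_{c_N}(0) · (p_0² - p_{N-1}²)(t)⟩_{N,T}` to a central
current fluctuation (junk `0` for `N < 2`); `γ (p_e² - T)` is the energy flux from bath `e` INTO the
chain's site `e` reversed, i.e. `-γ b(t)` is the observable net outflux RIGHT minus LEFT. -/
def boundaryResponse (ω₂ lam β γ T : ℝ) (N : ℕ) (t : ℝ) : ℝ :=
  if h : 2 ≤ N then
    ∫ z, (pinnedChain ω₂ lam β γ).bondCurrent N (centralBond N h) z *
        (∫ y, ((y.2 ⟨0, by omega⟩) ^ 2 - (y.2 ⟨N - 1, by omega⟩) ^ 2)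
            ∂((pinnedChain ω₂ lam β γ).transitionKernel N T T t.toNNReal z))
      ∂((pinnedChain ω₂ lam β γ).gibbsMeasure N T)
  else 0

/-- Its Abel transform `B̂_N(ν) = ∫₀^∞ e^{-νt} B_N(t) dt`. -/
def boundaryAbel (ω₂ lam β γ T : ℝ) (N : ℕ) (ν : ℝ) : ℝ :=
  ∫ t in Ioi (0:ℝ), Real.exp (-(ν * t)) * boundaryResponse ω₂ lam β γ T N t

/-- Weak-NESS uniqueness at all `N, T_L, T_R > 0` (the crux's first hypothesis, = `NessUnique`). -/
def Uniq (ω₂ lam β γ : ℝ) : Prop :=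
  ∀ (N : ℕ) (T_L T_R : ℝ), 0 < T_L → 0 < T_R → ∀ μ ν : Measure (PhaseSpace N),
    (pinnedChain ω₂ lam β γ).IsSteadyState N T_L T_R μ →
    (pinnedChain ω₂ lam β γ).IsSteadyState N T_L T_R ν → μ = ν

/-- `(μT, D, κ)` is an ABELIAN GREEN–KUBO WITNESS at `T` (verbatim the crux's hypothesis). -/
def IsAbelWitness (ω₂ lam β γ T : ℝ) (μT : Measure ChainConfig)
    (D : InfiniteChainDynamics (pinnedChain ω₂ lam β γ)) (κ : ℝ) : Prop :=
  (pinnedChain ω₂ lam β γ).IsChainGibbsMeasure T μT ∧ D.PreservesMeasure μT ∧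
    (∀ t : ℝ, D.HasAbsConvergentCorrelation μT t) ∧ 0 < κ ∧
    Tendsto (fun ν : ℝ => (T ^ 2)⁻¹ * ∫ t in Ioi (0:ℝ), Real.exp (-(ν * t)) * D.currentCorrelation μT t)
      (𝓝[>] 0) (𝓝 κ)

/-- `Dn` is a sequence of finite-volume response coefficients of the steady family `μ` at `T`. -/
def IsResponseSeq (ω₂ lam β γ T : ℝ) (μ : (N : ℕ) → ℝ → ℝ → Measure (PhaseSpace N))
    (Dn : ℕ → ℝ) : Prop :=
  (∀ (N : ℕ) (T_L T_R : ℝ), 0 < T_L → 0 < T_R →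
      (pinnedChain ω₂ lam β γ).IsSteadyState N T_L T_R (μ N T_L T_R)) ∧
  ∀ N : ℕ, Tendsto (fun δ : ℝ => (pinnedChain ω₂ lam β γ).totalCurrent (μ N (T + δ / 2) (T - δ / 2)) / δ)
      (𝓝[≠] 0) (𝓝 (Dn N))

/-! ### Idea `slow-abel-diagonal` — first lemmas -/

/-- (K_c) ANCHORED KUBO FORMULA / DC-FLATNESS (Kundu–Dhar–Narayan 2009, eqs. (reln1)–(reln3), for
every bond instead of the bond average): under uniqueness, `T² · D_N = A_N(0)` for `N ≥ 2`, with the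
time integrals absolutely convergent (fixed-`N` mixing, CEHR2018). -/
def AnchoredKubo : Prop :=
  ∀ ω₂ lam β γ : ℝ, 0 < ω₂ → 0 < lam → 0 < β → 0 < γ → Uniq ω₂ lam β γ → ∀ T : ℝ, 0 < T →
    ∀ μ Dn, IsResponseSeq ω₂ lam β γ T μ Dn → ∀ N : ℕ, 2 ≤ N →
      (∀ i k : Fin N, IntegrableOn (pairCorr ω₂ lam β γ T N i k) (Ioi 0)) ∧
      T ^ 2 * Dn N = anchoredAbel ω₂ lam β γ T N 0

/-- (E) EARLY-WINDOW MATCHING ALONG A SLOW ABELIAN DIAGONAL: for every Abelian Green–Kubo witness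
there is a sequence `ν_N ↓ 0` (chosen adaptively to the witness, as slowly as its Abel tails require)
along which the anchored open-chain Abelian sum reproduces the closed-chain Abel limit:
`A_N(ν_N) → T² κ`. Inputs: light-cone locality of open and closed chains, equivalence of the
free-boundary Gibbs marginal with the DLR state on the central window, canonical correlations of
the witness; NO decay, sign or boundedness assumption on `C_T`. -/
def EarlyWindowMatching : Prop :=
  ∀ ω₂ lam β γ : ℝ, 0 < ω₂ → 0 < lam → 0 < β → 0 < γ → ∀ T : ℝ, 0 < T →
    ∀ (μT : Measure ChainConfig) (D : InfiniteChainDynamics (pinnedChain ω₂ lam β γ)) (κ : ℝ),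
      IsAbelWitness ω₂ lam β γ T μT D κ →
      ∃ νs : ℕ → ℝ, (∀ N, 0 < νs N) ∧ Tendsto νs atTop (𝓝 0) ∧
        Tendsto (fun N : ℕ => anchoredAbel ω₂ lam β γ T N (νs N)) atTop (𝓝 (T ^ 2 * κ))

/-- Input 1 of (E): OPEN-CHAIN LIGHT CONE, uniform in `N` (the twin, with Ornstein–Uhlenbeck ends, of
`ButtaMarchioro2016_thm22_chain`; cone radius `v t (1 + log (1+t))^3`, exponential smallness outside,
static exponential clustering at `t = 0` included). -/
def OpenChainLightCone : Prop :=
  ∀ ω₂ lam β γ : ℝ, 0 < ω₂ → 0 < lam → 0 < β → 0 < γ → ∀ T : ℝ, 0 < T →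
    ∃ v C ξ : ℝ, 0 < v ∧ 0 < ξ ∧ ∀ N : ℕ, 2 ≤ N → ∀ i k : Fin N, i.val + 1 < N → k.val + 1 < N →
      ∀ t : ℝ, 0 ≤ t →
        |pairCorr ω₂ lam β γ T N i k t| ≤
          C * Real.exp (-((|((i.val : ℝ)) - k.val| - v * t * (1 + Real.log (1 + t)) ^ 3) / ξ))

/-- Input 2 of (E): FIXED-TIME MATCHING — inside the cone the anchored open-chain correlation at the
central bond converges, at every fixed time, to the witness's summed infinite-volume correlation
(canonical correlations of any measure-preserving witness + equivalence of the free-boundary Gibbs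
marginal with the DLR state on the central window; 1-D transfer operator). -/
def FixedTimeMatching : Prop :=
  ∀ ω₂ lam β γ : ℝ, 0 < ω₂ → 0 < lam → 0 < β → 0 < γ → ∀ T : ℝ, 0 < T →
    ∀ (μT : Measure ChainConfig) (D : InfiniteChainDynamics (pinnedChain ω₂ lam β γ)),
      (pinnedChain ω₂ lam β γ).IsChainGibbsMeasure T μT → D.PreservesMeasure μT →
      (∀ t : ℝ, D.HasAbsConvergentCorrelation μT t) →
      ∀ t : ℝ, 0 ≤ t →
        Tendsto (fun N : ℕ => if h : 2 ≤ N then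
            ∑ k : Fin N, pairCorr ω₂ lam β γ T N (centralBond N h) k t else 0)
          atTop (𝓝 (D.currentCorrelation μT t))

/-- (L) UNIFORM LATE-WINDOW FLATNESS (what is left of the crux; closed-chain-free): the anchored
Abelian sum of the OPEN chain is flat on `(0, ν₀]` uniformly in large `N`:
`∀ ε ∃ ν₀ ∃ N₀ ∀ N ≥ N₀ ∀ ν ∈ (0, ν₀], |A_N(0) - A_N(ν)| ≤ ε`. -/
def UniformLateFlatness : Prop :=
  ∀ ω₂ lam β γ : ℝ, 0 < ω₂ → 0 < lam → 0 < β → 0 < γ → ∀ T : ℝ, 0 < T →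
    ∀ ε : ℝ, 0 < ε → ∃ ν₀ : ℝ, 0 < ν₀ ∧ ∃ N₀ : ℕ, ∀ N : ℕ, N₀ ≤ N → ∀ ν : ℝ, 0 < ν → ν ≤ ν₀ →
      |anchoredAbel ω₂ lam β γ T N 0 - anchoredAbel ω₂ lam β γ T N ν| ≤ ε

/-- A real-variable diagonal lemma: if `d N = A N 0`, `A N (νs N) → L` along some `νs N ↓ 0`, and
`A N` is flat near `0` uniformly in large `N`, then `d N → L`. -/
theorem tendsto_of_diagonal_of_flat {A : ℕ → ℝ → ℝ} {d νs : ℕ → ℝ} {L : ℝ}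
    (hd : ∀ᶠ N in atTop, d N = A N 0)
    (hν : ∀ N, 0 < νs N) (hν0 : Tendsto νs atTop (𝓝 0))
    (hA : Tendsto (fun N => A N (νs N)) atTop (𝓝 L))
    (hflat : ∀ ε : ℝ, 0 < ε → ∃ ν₀ : ℝ, 0 < ν₀ ∧ ∃ N₀ : ℕ, ∀ N : ℕ, N₀ ≤ N →
      ∀ ν : ℝ, 0 < ν → ν ≤ ν₀ → |A N 0 - A N ν| ≤ ε) :
    Tendsto d atTop (𝓝 L) := by
  rw [Metric.tendsto_atTop]
  intro ε hε
  obtain ⟨ν₀, hν₀, N₀, hN₀⟩ := hflat (ε / 2) (half_pos hε)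
  have h1 : ∀ᶠ N in atTop, νs N ≤ ν₀ := (hν0.eventually (Iic_mem_nhds hν₀))
  have h2 : ∀ᶠ N in atTop, dist (A N (νs N)) L < ε / 2 :=
    (Metric.tendsto_nhds.mp hA) (ε / 2) (half_pos hε)
  obtain ⟨M, hM⟩ := (hd.and (h1.and (h2.and (eventually_ge_atTop N₀)))).exists_forall_of_atTop
  refine ⟨M, fun N hN => ?_⟩
  obtain ⟨hdN, hν1, hA2, hNN⟩ := hM N hN
  have hf := hN₀ N hNN (νs N) (hν N) hν1
  rw [hdN, Real.dist_eq]
  calc |A N 0 - L| = |(A N 0 - A N (νs N)) + (A N (νs N) - L)| := by ring_nf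
    _ ≤ |A N 0 - A N (νs N)| + |A N (νs N) - L| := abs_add_le _ _
    _ < ε / 2 + ε / 2 := by
        have := Real.dist_eq (A N (νs N)) L ▸ hA2
        linarith
    _ = ε := by ring

/-- REDUCTION (idea `slow-abel-diagonal`): anchored Kubo + early matching along a slow diagonal +
uniform late flatness prove the crux, with the GIVEN witness as the output witness. -/
theorem abelThermodynamicLimit_of (hK : AnchoredKubo) (hE : EarlyWindowMatching)
    (hL : UniformLateFlatness) :
    Summit.AtomisticToContinuum.FouriersLaw.Theses.EmbeddedDrudeMourre.AbelThermodynamicLimit := by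
  intro ω₂ lam β γ hω hl hβ hγ hU T hT hwit
  obtain ⟨μT, D, κ, hW⟩ := hwit
  refine ⟨μT, D, κ, hW, ?_⟩
  intro μ hμ Dn hDn
  obtain ⟨νs, hνpos, hν0, hA⟩ := hE ω₂ lam β γ hω hl hβ hγ T hT μT D κ hW
  have hKq := hK ω₂ lam β γ hω hl hβ hγ hU T hT μ Dn ⟨hμ, hDn⟩
  have hT2 : (T ^ 2) ≠ 0 := pow_ne_zero 2 hT.ne'
  -- work with d N := T² · Dn N
  have hd : ∀ᶠ N in atTop, T ^ 2 * Dn N = anchoredAbel ω₂ lam β γ T N 0 :=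
    (eventually_ge_atTop 2).mono fun N hN => (hKq N hN).2
  have hlim : Tendsto (fun N => T ^ 2 * Dn N) atTop (𝓝 (T ^ 2 * κ)) :=
    tendsto_of_diagonal_of_flat hd hνpos hν0 hA (hL ω₂ lam β γ hω hl hβ hγ T hT)
  have := hlim.const_mul ((T ^ 2)⁻¹)
  simpa [← mul_assoc, inv_mul_cancel₀ hT2] using this

/-! ### Idea `exit-ledger-slip-bound` — first lemmas -/

/-- (X) EXIT LEDGER (Kundu–Dhar–Narayan 2009 (reln2)–(reln3) anchored at the central bond + momentum-
reversal duality): `T² · D_N = -((N-1) γ / 2) · B̂_N(0)`, the conductance is `(N-1)/2` times the net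
energy eventually delivered to the right bath minus the left one after a central current fluctuation;
with absolute convergence of `B_N` on `(0, ∞)`. -/
def ExitLedger : Prop :=
  ∀ ω₂ lam β γ : ℝ, 0 < ω₂ → 0 < lam → 0 < β → 0 < γ → Uniq ω₂ lam β γ → ∀ T : ℝ, 0 < T →
    ∀ μ Dn, IsResponseSeq ω₂ lam β γ T μ Dn → ∀ N : ℕ, 2 ≤ N →
      IntegrableOn (boundaryResponse ω₂ lam β γ T N) (Ioi 0) ∧
      T ^ 2 * Dn N = -(((N : ℝ) - 1) * γ / 2) * boundaryAbel ω₂ lam β γ T N 0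

/-- (S) LATE SLIP BOUND: below some `ν₀`, uniformly in large `N`, the anchored Abelian sum varies at
most proportionally to the UNWEIGHTED boundary-imbalance transform, with an `N`-independent constant
`C` (a contact/slip coefficient; bookkeeping alone gives the useless constant `(N-1)γ/2`). -/
def LateSlipBound : Prop :=
  ∀ ω₂ lam β γ : ℝ, 0 < ω₂ → 0 < lam → 0 < β → 0 < γ → ∀ T : ℝ, 0 < T →
    ∃ C : ℝ, 0 ≤ C ∧ ∀ ε : ℝ, 0 < ε → ∃ ν₀ : ℝ, 0 < ν₀ ∧ ∃ N₀ : ℕ, ∀ N : ℕ, N₀ ≤ N →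
      ∀ ν ν' : ℝ, 0 ≤ ν → ν ≤ ν' → ν' ≤ ν₀ →
        |anchoredAbel ω₂ lam β γ T N ν - anchoredAbel ω₂ lam β γ T N ν'| ≤
          C * |boundaryAbel ω₂ lam β γ T N ν - boundaryAbel ω₂ lam β γ T N ν'| + ε

/-- (Σ) EXIT SIGN, robust form: the boundary-imbalance response is essentially single-signed —
its `L¹` norm equals the modulus of its integral up to `o(1)` (after arrival the energy kicked
rightward leaves on the right; before arrival `B_N` is exponentially small). -/
def ExitSign : Prop :=
  ∀ ω₂ lam β γ : ℝ, 0 < ω₂ → 0 < lam → 0 < β → 0 < γ → ∀ T : ℝ, 0 < T →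
    Tendsto (fun N : ℕ => (∫ t in Ioi (0:ℝ), |boundaryResponse ω₂ lam β γ T N t|) -
      |∫ t in Ioi (0:ℝ), boundaryResponse ω₂ lam β γ T N t|) atTop (𝓝 0)

/-- (β) SUB-BALLISTIC OPEN CHAIN: `D_N / N → 0` (implied by `HasBoundedResponse`; the open-chain twin
of "no Drude atom"). -/
def SubBallistic : Prop :=
  ∀ ω₂ lam β γ : ℝ, 0 < ω₂ → 0 < lam → 0 < β → 0 < γ → Uniq ω₂ lam β γ → ∀ T : ℝ, 0 < T →
    ∀ μ Dn, IsResponseSeq ω₂ lam β γ T μ Dn → Tendsto (fun N : ℕ => Dn N / N) atTop (𝓝 0)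

/-- REDUCTION (idea `exit-ledger-slip-bound`), response-sequence form of late flatness: under
(K_c), (X), (S), (Σ), (β), for every steady family and response sequence,
`sup_{0<ν≤ν₀} |T² D_N - A_N(ν)| → 0`; together with (E) this is the crux (previous theorem's proof). -/
def LateFlatnessAlongResponses : Prop :=
  ∀ ω₂ lam β γ : ℝ, 0 < ω₂ → 0 < lam → 0 < β → 0 < γ → Uniq ω₂ lam β γ → ∀ T : ℝ, 0 < T →
    ∀ μ Dn, IsResponseSeq ω₂ lam β γ T μ Dn →
      ∀ ε : ℝ, 0 < ε → ∃ ν₀ : ℝ, 0 < ν₀ ∧ ∃ N₀ : ℕ, ∀ N : ℕ, N₀ ≤ N → ∀ ν : ℝ, 0 < ν → ν ≤ ν₀ →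
        |T ^ 2 * Dn N - anchoredAbel ω₂ lam β γ T N ν| ≤ ε

/-- For `ν > 0` the Abel transforms at `0` and at `ν` differ by at most the `L¹` norm. -/
theorem abs_boundaryAbel_sub_le {ω₂ lam β γ T : ℝ} {N : ℕ}
    (hB : IntegrableOn (boundaryResponse ω₂ lam β γ T N) (Ioi 0)) {ν : ℝ} (hν : 0 < ν) :
    |boundaryAbel ω₂ lam β γ T N 0 - boundaryAbel ω₂ lam β γ T N ν| ≤
      ∫ t in Ioi (0:ℝ), |boundaryResponse ω₂ lam β γ T N t| := by
  set B := boundaryResponse ω₂ lam β γ T N with hBdef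
  have hmeas : AEStronglyMeasurable (fun t : ℝ => Real.exp (-(ν * t))) (volume.restrict (Ioi 0)) :=
    (by fun_prop : Continuous fun t : ℝ => Real.exp (-(ν * t))).aestronglyMeasurable
  have hbd : ∀ᵐ t ∂(volume.restrict (Ioi (0:ℝ))), ‖Real.exp (-(ν * t))‖ ≤ 1 := by
    filter_upwards [ae_restrict_mem measurableSet_Ioi] with t ht
    rw [Real.norm_eq_abs, abs_of_pos (Real.exp_pos _)]
    have : -(ν * t) ≤ 0 := by have := mul_pos hν (show (0:ℝ) < t from ht); linarith
    exact Real.exp_le_one_iff.mpr this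
  have hInt : Integrable (fun t => Real.exp (-(ν * t)) * B t) (volume.restrict (Ioi 0)) :=
    hB.bdd_mul' hmeas hbd
  have h0 : boundaryAbel ω₂ lam β γ T N 0 = ∫ t in Ioi (0:ℝ), B t := by
    simp [boundaryAbel, hBdef]
  have hνe : boundaryAbel ω₂ lam β γ T N ν = ∫ t in Ioi (0:ℝ), Real.exp (-(ν * t)) * B t := rfl
  rw [h0, hνe, ← integral_sub hB hInt]
  have hle : ∀ᵐ t ∂(volume.restrict (Ioi (0:ℝ))), ‖B t - Real.exp (-(ν * t)) * B t‖ ≤ |B t| := by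
    filter_upwards [ae_restrict_mem measurableSet_Ioi] with t ht
    have h1 : Real.exp (-(ν * t)) ≤ 1 := by
      have : -(ν * t) ≤ 0 := by have := mul_pos hν (show (0:ℝ) < t from ht); linarith
      exact Real.exp_le_one_iff.mpr this
    rw [Real.norm_eq_abs, show B t - Real.exp (-(ν * t)) * B t = (1 - Real.exp (-(ν * t))) * B t by ring,
      abs_mul, abs_of_nonneg (by linarith : (0:ℝ) ≤ 1 - Real.exp (-(ν * t)))]
    calc (1 - Real.exp (-(ν * t))) * |B t| ≤ 1 * |B t| :=
          mul_le_mul_of_nonneg_right (by linarith [(Real.exp_pos (-(ν * t))).le]) (abs_nonneg _)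
      _ = |B t| := one_mul _
  have := norm_integral_le_of_norm_le hB.abs hle
  simpa [Real.norm_eq_abs] using this

theorem lateFlatness_of_exitLedger (hK : AnchoredKubo) (hX : ExitLedger) (hS : LateSlipBound)
    (hSig : ExitSign) (hβ : SubBallistic) : LateFlatnessAlongResponses := by
  intro ω₂ lam β γ hω hl hβ' hγ hU T hT μ Dn hR ε hε
  obtain ⟨C, hC0, hC⟩ := hS ω₂ lam β γ hω hl hβ' hγ T hT
  obtain ⟨ν₀, hν₀, N₀, hN₀⟩ := hC (ε / 2) (half_pos hε)
  set B : ℕ → ℝ → ℝ := fun N t => boundaryResponse ω₂ lam β γ T N t with hBdef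
  -- Step 1: |∫ B_N| → 0 (exit ledger + sub-ballisticity)
  have hDn : Tendsto (fun N : ℕ => Dn N / N) atTop (𝓝 0) := hβ ω₂ lam β γ hω hl hβ' hγ hU T hT μ Dn hR
  have habsDn : Tendsto (fun N : ℕ => (4 * T ^ 2 / γ) * |Dn N / N|) atTop (𝓝 0) := by
    have := (continuous_abs.tendsto (0:ℝ)).comp hDn
    simpa using this.const_mul (4 * T ^ 2 / γ)
  have h2 : Tendsto (fun N : ℕ => |∫ t in Ioi (0:ℝ), B N t|) atTop (𝓝 0) := by
    refine squeeze_zero' (Eventually.of_forall fun N => abs_nonneg _) ?_ habsDn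
    filter_upwards [eventually_ge_atTop 2] with N hN
    have hXN := (hX ω₂ lam β γ hω hl hβ' hγ hU T hT μ Dn hR N hN).2
    have hB0 : boundaryAbel ω₂ lam β γ T N 0 = ∫ t in Ioi (0:ℝ), B N t := by
      simp [boundaryAbel, hBdef]
    have hN2 : (2:ℝ) ≤ N := by exact_mod_cast hN
    have hN1 : (0:ℝ) < (N:ℝ) - 1 := by linarith
    have hNpos : (0:ℝ) < N := by linarith
    rw [hB0] at hXN
    -- ∫ B = -(2 / ((N-1) γ)) T² Dn N
    have hI : ∫ t in Ioi (0:ℝ), B N t = -(2 / (((N:ℝ) - 1) * γ)) * (T ^ 2 * Dn N) := by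
      have hne : ((N:ℝ) - 1) * γ ≠ 0 := by positivity
      rw [hXN]; field_simp
    rw [hI, abs_mul, abs_neg, abs_of_pos (by positivity : (0:ℝ) < 2 / (((N:ℝ) - 1) * γ)), abs_mul,
      abs_of_pos (by positivity : (0:ℝ) < T ^ 2), abs_div, abs_of_pos hNpos]
    -- 2/((N-1)γ) T² |Dn N| ≤ 4 T²/γ |Dn N| / N  since N ≤ 2 (N - 1)
    rw [div_mul_eq_mul_div, div_le_iff₀ (by positivity : (0:ℝ) < ((N:ℝ) - 1) * γ)]
    rw [show 4 * T ^ 2 / γ * (|Dn N| / (N:ℝ)) * (((N:ℝ) - 1) * γ) = (2 * (T ^ 2 * |Dn N|)) * (2 * ((N:ℝ) - 1) / N) by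
      field_simp; ring]
    have hratio : (1:ℝ) ≤ 2 * ((N:ℝ) - 1) / N := by
      rw [le_div_iff₀ hNpos]; linarith
    have hnn : (0:ℝ) ≤ 2 * (T ^ 2 * |Dn N|) := by positivity
    calc 2 * (T ^ 2 * |Dn N|) = 2 * (T ^ 2 * |Dn N|) * 1 := (mul_one _).symm
      _ ≤ 2 * (T ^ 2 * |Dn N|) * (2 * ((N:ℝ) - 1) / N) := mul_le_mul_of_nonneg_left hratio hnn
  -- Step 2: ∫ |B_N| → 0 (exit sign)
  have hsmall : Tendsto (fun N : ℕ => ∫ t in Ioi (0:ℝ), |B N t|) atTop (𝓝 0) := by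
    have h1 := hSig ω₂ lam β γ hω hl hβ' hγ T hT
    have := h1.add h2
    simp only [zero_add] at this
    refine this.congr' (Eventually.of_forall fun N => ?_)
    simp [hBdef]
  -- Step 3: combine with the slip bound and the anchored Kubo formula
  have hε' : 0 < ε / (2 * (C + 1)) := by positivity
  obtain ⟨N₁, hN₁⟩ := (Metric.tendsto_atTop.mp hsmall) (ε / (2 * (C + 1))) hε'
  refine ⟨ν₀, hν₀, max (max N₀ N₁) 2, fun N hN ν hν hνle => ?_⟩
  have hNN₀ : N₀ ≤ N := le_trans (le_trans (le_max_left _ _) (le_max_left _ _)) hN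
  have hNN₁ : N₁ ≤ N := le_trans (le_trans (le_max_right _ _) (le_max_left _ _)) hN
  have hN2 : 2 ≤ N := le_trans (le_max_right _ _) hN
  have hKN := hK ω₂ lam β γ hω hl hβ' hγ hU T hT μ Dn hR N hN2
  have hXN := (hX ω₂ lam β γ hω hl hβ' hγ hU T hT μ Dn hR N hN2).1
  rw [hKN.2]
  have hslip := hN₀ N hNN₀ 0 ν le_rfl hν.le hνle
  have hdiff := abs_boundaryAbel_sub_le (ω₂ := ω₂) (lam := lam) (β := β) (γ := γ) (T := T) (N := N) hXN hν
  have hL1 : ∫ t in Ioi (0:ℝ), |B N t| < ε / (2 * (C + 1)) := by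
    have := hN₁ N hNN₁
    rw [Real.dist_eq, sub_zero, abs_of_nonneg (integral_nonneg fun t => abs_nonneg _)] at this
    exact this
  have hCB : C * |boundaryAbel ω₂ lam β γ T N 0 - boundaryAbel ω₂ lam β γ T N ν| ≤ C * (ε / (2 * (C + 1))) :=
    mul_le_mul_of_nonneg_left (le_trans hdiff hL1.le) hC0
  have hC1 : C * (ε / (2 * (C + 1))) ≤ ε / 2 := by
    rw [show C * (ε / (2 * (C + 1))) = (ε / 2) * (C / (C + 1)) by field_simp]
    have : C / (C + 1) ≤ 1 := by rw [div_le_one (by positivity)]; linarith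
    calc ε / 2 * (C / (C + 1)) ≤ ε / 2 * 1 := mul_le_mul_of_nonneg_left this (by positivity)
      _ = ε / 2 := mul_one _
  linarith

/-- REDUCTION (idea `exit-ledger-slip-bound`, end to end): anchored Kubo + early matching +
exit ledger + late slip bound + exit sign + sub-ballisticity prove the crux. -/
theorem abelThermodynamicLimit_of_exitLedger (hK : AnchoredKubo) (hE : EarlyWindowMatching)
    (hX : ExitLedger) (hS : LateSlipBound) (hSig : ExitSign) (hβ : SubBallistic) :
    Summit.AtomisticToContinuum.FouriersLaw.Theses.EmbeddedDrudeMourre.AbelThermodynamicLimit := by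
  have hLF := lateFlatness_of_exitLedger hK hX hS hSig hβ
  intro ω₂ lam β γ hω hl hβ' hγ hU T hT hwit
  obtain ⟨μT, D, κ, hW⟩ := hwit
  refine ⟨μT, D, κ, hW, ?_⟩
  intro μ hμ Dn hDn
  obtain ⟨νs, hνpos, hν0, hA⟩ := hE ω₂ lam β γ hω hl hβ' hγ T hT μT D κ hW
  have hKq := hK ω₂ lam β γ hω hl hβ' hγ hU T hT μ Dn ⟨hμ, hDn⟩
  have hT2 : (T ^ 2) ≠ 0 := pow_ne_zero 2 hT.ne'
  have hd : ∀ᶠ N in atTop, T ^ 2 * Dn N = anchoredAbel ω₂ lam β γ T N 0 :=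
    (eventually_ge_atTop 2).mono fun N hN => (hKq N hN).2
  have hflat : ∀ ε : ℝ, 0 < ε → ∃ ν₀ : ℝ, 0 < ν₀ ∧ ∃ N₀ : ℕ, ∀ N : ℕ, N₀ ≤ N →
      ∀ ν : ℝ, 0 < ν → ν ≤ ν₀ →
        |anchoredAbel ω₂ lam β γ T N 0 - anchoredAbel ω₂ lam β γ T N ν| ≤ ε := by
    intro ε hε
    obtain ⟨ν₀, hν₀, N₀, hN₀⟩ := hLF ω₂ lam β γ hω hl hβ' hγ hU T hT μ Dn ⟨hμ, hDn⟩ ε hε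
    refine ⟨ν₀, hν₀, max N₀ 2, fun N hN ν hν hνle => ?_⟩
    have h1 := hN₀ N (le_trans (le_max_left _ _) hN) ν hν hνle
    rwa [(hKq N (le_trans (le_max_right _ _) hN)).2] at h1
  have hlim : Tendsto (fun N => T ^ 2 * Dn N) atTop (𝓝 (T ^ 2 * κ)) :=
    tendsto_of_diagonal_of_flat hd hνpos hν0 hA hflat
  have := hlim.const_mul ((T ^ 2)⁻¹)
  simpa [← mul_assoc, inv_mul_cancel₀ hT2] using this

end Summit.AtomisticToContinuum.FouriersLaw.Cruxes.AbelThermodynamicLimit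

end
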